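/-
Origin: expansion seat `prover-pub-hodgecm-mc-binder-2-g17-0`, handover #91 2026-08-20T20:24Z md5 3a4044e6581f (NEW; 230 l.; r3 = r2 + `isCorner_of_scope` + import `HodgeCM.Model.Binders.JLiuPrimitive`; r2 = r1 + `IsReflexOfTypeG` + `isCorner_of_isReflexOfTypeG_liftType`; ns `HodgeCM.Model` + `HodgeCM.Model.LiuCMSide`; (J5-corner): `Model.exists_comp_eq_of_ringHom` (extension of embeddings `K → ℂ` along `j : K → L`, number fields, via `IsAlgClosed.lift`), abbrevs `autImage`/`reflexFieldOf` (vendored `reflexField ℚ L (↑ '' T)`), def `reflexTypeC ι₁ T` (restrictions of `ι₁ ∘ g`, `g ∈ reflexLift (↑''T) id`), predicates `IsReflexOf ι₁ C T` (∃ ε : C.K' ≃+* ↥(reflexFieldOf T), τ ∘ k = ι₁ ∘ incl ∘ ε ∧ Φ' ↔ reflexTypeC) and `IsReflexOfType ι₁ C (Φ : CMType L) := IsReflexOf ι₁ C (autSet ι₁ Φ)` with `autSet ι₁ Φ := {g | ι₁ ∘ g ∈ Φ}`, `autSet_liftType_false : autSet ι₁ (liftType false K L j ι₁ Ψ) = reflexLift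 (pullbackTypeAlg ι₁ Ψ) j.toRatAlgHom` (binder-1 (R1)); MAIN **`isCorner_of_isReflexOf [IsGalois ℚ L] (C) (Ψ) (j) (hP : IsPrimitive (L ≃ₐ[ℚ] L) (pullbackTypeAlg ι₁ Ψ) j.toRatAlgHom) (h : C.IsReflexOf ι₁ S*(Ψ_L,j)) : C.IsCorner K Ψ (ι₁.comp j)`** (RF1 field half `reflexField_liftTypeSet_eq_fieldRange` ⇒ `e := j ; ε⁻¹`; type half `image_reflexLift_liftTypeSet_eq_pullbackTypeAlg` both inclusions, the reverse one through `exists_comp_eq_of_ringHom` + `CMTypeOps.exists_eq_comp`) and **`isCorner_of_isReflexOfType_liftType … (h : C.IsReflexOfType ι₁ (liftType false K L j ι₁ Ψ)) : C.IsCorner K Ψ (ι₁.comp j)`** = axioms-1's asked `isCorner_of_isReflexOf_liftType`. CERT lane farm rc 0 ∕ 10 s ∕ 0 warn ∕ proof holes 0; `#print axioms` 11 ∕ 11 ⊆ trio (`g17/farm/logs/ax_corner.log`); FQN 0 hits; NAME LIST: `HodgeCM.Model.LiuCMSide.isCorner_of_isReflexOf` · `HodgeCM.Model.LiuCMSide.isCorner_of_isReflexOfType_liftType`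 · `HodgeCM.Model.LiuCMSide.isCorner_of_scope`) (`HOME/mc/pub-hodgecm-mc-binder-2/g17/stage62/HodgeCM/Model/Binders/JLiuCornerOfReflex.lean`, md5 3a4044e6581f, 230 lines);
landed by the second packager p2 gen 13 (p2-g13) in gate run 62 as `HodgeCM/Model/Binders/JLiuCornerOfReflex.lean` (verbatim).
-/
/-
binder-2 lane (unit pub-hodgecm-mc-binder-2-g17, seat prover-pub-hodgecm-mc-binder-2-g17-0), 2026-08-20.
(J-Liu-Θ) junction behind E's row 9 `hΘ` — item (J5-corner): the per-context input `LiuCMSide.IsCorner` of the (J3) junction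
(axioms-1-g15 J3-DESIGN v1.2/v1.3, `subset_span_of_liuDictionary`) from the REFLEX typing of the CM side ([Liu21] Def. 4.3: `M'_μ` = the reflex
field of `(E, Φ_μ)` with the reflex type `Ψ_μ`) and the (J4a) identification `Φ_μ = S*(Ψ_i, j)` — via binder-1's (RF1)
`reflexField_liftTypeSet_eq_fieldRange` / `image_reflexLift_liftTypeSet_eq_pullbackTypeAlg` (PerL Lemma [lem:reflex] (b)).
Imports binder-1's #R87 `Model/Binders/JLiuReflexField` + binder-2's (J5-dict) `Model/Binders/JLiuCommonReflexOfCMData` only.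
No `Prop` minted; nothing of E / row 9 / MODEL-N touched.
-/
import Summits.HodgeConjecture.HodgeCM.Model.Binders.JLiuReflexField
import Summits.HodgeConjecture.HodgeCM.Model.Binders.JLiuPrimitive
import Summits.HodgeConjecture.HodgeCM.Model.Binders.JLiuCommonReflexOfCMData
import Summits.HodgeConjecture.HodgeCM.CM.ReflexInflate

set_option autoImplicit false

/-!
# (J5-corner): `IsCorner` from the reflex typing of the CM side

For an `L`-type given as a set `T ⊆ Aut_ℚ(L)` (base point `id`; for (J4a): `T = S*(Ψ_L, j) = reflexLift (pullbackTypeAlg ι₁ Ψ) j`,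
binder-1 (R1) `liftType false … = S*`):
* `reflexFieldOf T` — its reflex field INSIDE `L` (vendored `reflexField`, Shimura §8.3 Prop. 28: the fixed field of `H*`);
* `reflexTypeC ι₁ T` — its reflex type as embeddings of that field into `ℂ`: the restrictions of `ι₁ ∘ g`, `g ∈ reflexLift (↑ '' T) id`;
* `LiuCMSide.IsReflexOf ι₁ C T` — the CM side `C` (reflex pair `(K', Φ')`, `M ⊇ K'`, `τ : M → ℂ`) IS the reflex side of `T` read in `ℂ`
  through `ι₁`: an isomorphism `ε : K' ≃ reflexFieldOf T` with `τ ∘ k = ι₁ ∘ incl ∘ ε` carrying `Φ'` to `reflexTypeC ι₁ T`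
  (= [Liu21] Def. 4.3 «`M'_μ ⊆ ℂ` the reflex field of `(E, Φ_μ)`, with the induced CM type `Ψ_μ`», for `L/ℚ` Galois);
* `LiuCMSide.isCorner_of_isReflexOf` — **for `L/ℚ` Galois, `(Ψ_L, j)` primitive (binder-2 #85 at PerL's scope) and `C` the reflex side of
  `S*(Ψ_L, j)`: `C.IsCorner K Ψ σ`** (`σ = ι₁ ∘ j`): the corner field `K` IS the reflex field (`e := j` followed by `ε⁻¹`), the corner type IS the
  reflex type (RF1 type half + extension of embeddings of `K` to `L`, `exists_comp_eq_of_ringHom`, + the `Aut(L)`-orbit of `ι₁`, `CMTypeOps.exists_eq_comp`).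
Hence, with `exists_commonReflexInput_of_isCorner`, the junction's `hJ5`/`hcorner` is DISCHARGED for every `μ` whose CM side is typed as the reflex side
of `Φ_μ = S*(Ψ_i, j)`.

KIND: kernel, 0 proof holes, nothing cited anew; expected `#print axioms` ⊆ {propext, Classical.choice, Quot.sound}.
-/

noncomputable section

open scoped Pointwise
open NumberField
open Literature.AlgebraicGeometry.Motives (CMType)
open Literature.NumberTheory.ComplexMultiplication

namespace HodgeCM

namespace Model

/-- Extension of embeddings: every `φ : K → ℂ` extends along `j : K → L` to some `τ : L → ℂ` (number fields; `ℂ` algebraically closed,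
`L/K` algebraic). [folklore] -/
theorem exists_comp_eq_of_ringHom {K L : Type*} [Field K] [NumberField K] [Field L] [NumberField L]
    (j : K →+* L) (φ : K →+* ℂ) : ∃ τ : L →+* ℂ, τ.comp j = φ := by
  letI : Algebra K L := j.toAlgebra
  letI : Algebra K ℂ := φ.toAlgebra
  haveI : IsScalarTower ℚ K L := IsScalarTower.of_algebraMap_eq fun r => by
    simp [RingHom.algebraMap_toAlgebra, map_ratCast]
  haveI : Algebra.IsAlgebraic K L := Algebra.IsAlgebraic.tower_top (K := ℚ) K
  refine ⟨(IsAlgClosed.lift : L →ₐ[K] ℂ).toRingHom, ?_⟩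
  ext x
  have := (IsAlgClosed.lift : L →ₐ[K] ℂ).commutes x
  simpa [RingHom.algebraMap_toAlgebra] using this

namespace LiuCMSide

open HodgeCM.SignRecipe (pullbackTypeAlg)

variable {L : CMField} (ι₁ : L →+* ℂ)

/-- `↑ '' T ⊆ Hom_ℚ(L, L)` for `T ⊆ Aut_ℚ(L)`. [folklore] -/
abbrev autImage (T : Set (L ≃ₐ[ℚ] L)) : Set (L →ₐ[ℚ] L) := (fun σ : L ≃ₐ[ℚ] L => (σ : L →ₐ[ℚ] L)) '' T

/-- The reflex field, inside `L`, of the `L`-type `T` (base point `id`). [folklore] -/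
abbrev reflexFieldOf (T : Set (L ≃ₐ[ℚ] L)) : IntermediateField ℚ L := reflexField ℚ L (autImage T)

/-- The reflex type of the `L`-type `T`, read as embeddings of its reflex field into `ℂ` through `ι₁`: the restrictions of `ι₁ ∘ g`,
`g` in the lifted reflex type `reflexLift (↑ '' T) id`. [folklore] -/
def reflexTypeC (T : Set (L ≃ₐ[ℚ] L)) : Set (↥(reflexFieldOf T) →+* ℂ) :=
  {ψ | ∃ g ∈ (reflexLift (autImage T) (AlgHom.id ℚ L) : Set (L ≃ₐ[ℚ] L)),
    ψ = (ι₁.comp (g : L →+* L)).comp (algebraMap (↥(reflexFieldOf T)) L)}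

/-- **`C` is the reflex side of the `L`-type `T`, read in `ℂ` through `ι₁`** ([Liu21] Def. 4.3 shape): `K' ≅ reflexFieldOf T` compatibly
with `τ ∘ k` and `ι₁`, and `Φ'` = the reflex type. [folklore] -/
def IsReflexOf (C : LiuCMSide) (T : Set (L ≃ₐ[ℚ] L)) : Prop :=
  ∃ ε : C.K' ≃+* ↥(reflexFieldOf T),
    C.τ.comp C.k = (ι₁.comp (algebraMap (↥(reflexFieldOf T)) L)).comp ε.toRingHom ∧
    ∀ ψ : C.K' →+* ℂ, ψ ∈ C.Φ' ↔ ψ.comp ε.symm.toRingHom ∈ reflexTypeC ι₁ T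

variable {ι₁}

/-- **(J5-corner)**: for `L/ℚ` Galois, `(Ψ_L, j)` primitive, and `C` the reflex side of `S*(Ψ_L, j)` through `ι₁`, the corner
`(K, Ψ, ι₁ ∘ j)` matches `C`. [folklore] -/
theorem isCorner_of_isReflexOf [IsGalois ℚ L] (C : LiuCMSide) {K : CMField} (Ψ : CMType K)
    (j : K →+* L) (hP : IsPrimitive (L ≃ₐ[ℚ] L) (pullbackTypeAlg ι₁ Ψ) j.toRatAlgHom)
    (h : C.IsReflexOf ι₁ (reflexLift (pullbackTypeAlg ι₁ Ψ) j.toRatAlgHom : Set (L ≃ₐ[ℚ] L))) :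
    C.IsCorner K Ψ (ι₁.comp j) := by
  set T : Set (L ≃ₐ[ℚ] L) := (reflexLift (pullbackTypeAlg ι₁ Ψ) j.toRatAlgHom : Set (L ≃ₐ[ℚ] L)) with hT
  obtain ⟨ε, hτ, hΦ⟩ := h
  -- the reflex field of `S*` is `j(K)` (RF1, primitivity)
  have hRF : reflexFieldOf T = (j.toRatAlgHom : K →ₐ[ℚ] L).fieldRange :=
    SignRecipe.reflexField_liftTypeSet_eq_fieldRange Ψ hP
  have hmem : ∀ x : K, j x ∈ reflexFieldOf T := fun x => by
    rw [hRF, AlgHom.mem_fieldRange]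
    exact ⟨x, rfl⟩
  let j' : K →+* ↥(reflexFieldOf T) := j.codRestrict (reflexFieldOf T) hmem
  have hj'val : ∀ x : K, ((j' x : ↥(reflexFieldOf T)) : L) = j x := fun _ => rfl
  have hj'bij : Function.Bijective j' := by
    refine ⟨fun x y hxy => j.injective (by simpa [hj'val] using congrArg (fun z : ↥(reflexFieldOf T) => (z : L)) hxy),
      fun y => ?_⟩
    have hy : (y : L) ∈ (j.toRatAlgHom : K →ₐ[ℚ] L).fieldRange := hRF ▸ y.2
    obtain ⟨x, hx⟩ := (AlgHom.mem_fieldRange).mp hy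
    exact ⟨x, Subtype.ext (by rw [hj'val]; exact hx)⟩
  let e₁ : K ≃+* ↥(reflexFieldOf T) := RingEquiv.ofBijective j' hj'bij
  have he₁ : ∀ x : K, ((e₁ x : ↥(reflexFieldOf T)) : L) = j x := fun _ => rfl
  have halg : ∀ x : K, algebraMap (↥(reflexFieldOf T)) L (e₁ x) = j x := fun _ => rfl
  refine ⟨e₁.trans ε.symm, fun ψ => ?_, ?_⟩
  · -- the type: `ψ ∈ Φ' ↔ ψ ∘ ε⁻¹ ∘ e₁⁻¹… ` — compute `ψ ∘ (e₁.trans ε.symm) = (ψ ∘ ε.symm) ∘ e₁`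
    rw [hΦ ψ]
    have hcomp : ψ.comp (e₁.trans ε.symm).toRingHom = (ψ.comp ε.symm.toRingHom).comp e₁.toRingHom := by
      ext x; rfl
    rw [hcomp]
    constructor
    · rintro ⟨g, hg, hψg⟩
      -- `g ∈ reflexLift (↑''S*) id` ⇒ `g • j ∈ Ψ_L` (RF1 type half, ⊆)
      have h1 : g • (j.toRatAlgHom : K →ₐ[ℚ] L) ∈ pullbackTypeAlg ι₁ Ψ := by
        rw [← SignRecipe.image_reflexLift_liftTypeSet_eq_pullbackTypeAlg (j := j) (ι₁ := ι₁) Ψ]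
        exact ⟨g, hg, rfl⟩
      rw [SignRecipe.mem_pullbackTypeAlg_iff] at h1
      rw [hψg]
      convert h1 using 1
      ext x
      simp [halg]
    · intro hψ
      -- extend `φ := (ψ ∘ ε⁻¹) ∘ e₁ : K → ℂ` to `L`, write it as `ι₁ ∘ g`, and land `g` in the reflex type
      obtain ⟨τ', hτ'⟩ := exists_comp_eq_of_ringHom j ((ψ.comp ε.symm.toRingHom).comp e₁.toRingHom)
      obtain ⟨g₀, hg₀⟩ := CMTypeOps.exists_eq_comp (L := L) inferInstance ι₁ τ'
      let g : L ≃ₐ[ℚ] L := AlgEquiv.ofRingEquiv (f := g₀) fun r => by simp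
      have hgφ : ι₁.comp ((g • (j.toRatAlgHom : K →ₐ[ℚ] L)).toRingHom) =
          (ψ.comp ε.symm.toRingHom).comp e₁.toRingHom := by
        rw [← hτ', hg₀]; ext x; rfl
      have h1 : g • (j.toRatAlgHom : K →ₐ[ℚ] L) ∈ pullbackTypeAlg ι₁ Ψ := by
        rw [SignRecipe.mem_pullbackTypeAlg_iff, hgφ]; exact hψ
      rw [← SignRecipe.image_reflexLift_liftTypeSet_eq_pullbackTypeAlg (j := j) (ι₁ := ι₁) Ψ] at h1
      obtain ⟨g', hg', hgg'⟩ := h1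
      refine ⟨g', hg', ?_⟩
      -- both sides agree after composing with the surjection `e₁`
      have hsurj : Function.Surjective e₁.toRingHom := e₁.surjective
      apply RingHom.ext
      intro y
      obtain ⟨x, rfl⟩ := hsurj y
      have hx := congrArg (fun (f : K →+* ℂ) => f x) hgφ.symm
      -- `(ψ ∘ ε⁻¹) (e₁ x) = ι₁ (g (j x)) = ι₁ (g' (j x))`
      have hgg'x : g' (j x) = g (j x) := by
        have := congrArg (fun (f : K →ₐ[ℚ] L) => f x) hgg'
        simpa using this
      simp only [RingHom.comp_apply] at hx ⊢
      rw [hx]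
      show ι₁ ((g : L →ₐ[ℚ] L) (j.toRatAlgHom x)) = ι₁ ((g' : L →+* L) (algebraMap _ L (e₁.toRingHom x)))
      rw [RingEquiv.toRingHom_eq_coe, RingEquiv.coe_toRingHom, halg, RingHom.toRatAlgHom_apply]
      exact congrArg ι₁ (by simpa using hgg'x.symm)
  · -- the embedding: `τ ∘ k ∘ (e₁ ; ε⁻¹) = ι₁ ∘ incl ∘ ε ∘ ε⁻¹ ∘ e₁ = ι₁ ∘ j`
    have : C.τ.comp (C.k.comp (e₁.trans ε.symm).toRingHom) = (C.τ.comp C.k).comp (e₁.trans ε.symm).toRingHom := by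
      rfl
    rw [this, hτ]
    ext x
    show ι₁ (algebraMap _ L (ε (ε.symm (e₁ x)))) = ι₁ (j x)
    rw [RingEquiv.apply_symm_apply, halg]

/-! ### `CMType`-facing form: the reflex side of a type `Φ` of `L`, and the (J4a) case `Φ = liftType false … Ψ` -/

variable (ι₁)

/-- The automorphisms of `L` inducing, through `ι₁`, an element of the `L`-type `Φ` (for `L/ℚ` normal every complex embedding is
`ι₁ ∘ g`, so this set IS `Φ`). [folklore] -/
def autSet (Φ : CMType L) : Set (L ≃ₐ[ℚ] L) := {g | ι₁.comp g.toRingEquiv.toRingHom ∈ Φ.1}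

/-- (J4a)/(R1): the automorphism set of `liftType false K L j ι₁ Ψ` is `S*(Ψ_L, j)` — binder-1's
`mem_liftType_false_iff_mem_reflexLift_alg`, as a set identity. [folklore] -/
theorem autSet_liftType_false {K : CMField} (j : K →+* L) (Ψ : CMType K) :
    autSet ι₁ (SignRecipe.liftType false K L j ι₁ Ψ) =
      (reflexLift (pullbackTypeAlg ι₁ Ψ) j.toRatAlgHom : Set (L ≃ₐ[ℚ] L)) :=
  Set.ext fun g => SignRecipe.mem_liftType_false_iff_mem_reflexLift_alg Ψ g

/-- **`C` is the reflex side of the CM type `Φ` of `L`** ([Liu21] Def. 4.3 with `(E, Φ_μ) = (L, Φ)`: `K' = M'_μ` the reflex field,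
`Φ' = Ψ_μ` the reflex type, `τ ∘ k` = the inclusions `M'_μ ⊆ M_μ ⊆ ℂ`), read inside `L` through `ι₁`. This is the ADMISSIBILITY
PREDICATE `adm μ d := d.IsReflexOfType ι₁ Φ_μ` of the (J3) dictionary v1.3 (axioms-1-g15). [folklore] -/
def IsReflexOfType (C : LiuCMSide) (Φ : CMType L) : Prop := C.IsReflexOf ι₁ (autSet ι₁ Φ)

variable {ι₁}

/-- **(J5-corner), `CMType` form — the junction's `hcorner`**: for `L/ℚ` Galois, `(Ψ_L, j)` primitive (binder-2 #85 at PerL's scope),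
and `C` the reflex side of the (J4a) type `liftType false K L j ι₁ Ψ` (= `Φ_μ` of every theta class of the corner, theta-3 (T4) /
binder-1 (S1)): `C.IsCorner K Ψ (ι₁ ∘ j)`. [folklore] -/
theorem isCorner_of_isReflexOfType_liftType [IsGalois ℚ L] (C : LiuCMSide) {K : CMField} (Ψ : CMType K)
    (j : K →+* L) (hP : IsPrimitive (L ≃ₐ[ℚ] L) (pullbackTypeAlg ι₁ Ψ) j.toRatAlgHom)
    (h : C.IsReflexOfType ι₁ (SignRecipe.liftType false K L j ι₁ Ψ)) : C.IsCorner K Ψ (ι₁.comp j) := by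
  have h' : C.IsReflexOf ι₁ (reflexLift (pullbackTypeAlg ι₁ Ψ) j.toRatAlgHom : Set (L ≃ₐ[ℚ] L)) := by
    have hT := autSet_liftType_false ι₁ j Ψ
    unfold IsReflexOfType at h
    rw [hT] at h
    exact h
  exact isCorner_of_isReflexOf C Ψ j hP h'

variable (ι₁) in
/-- **Galois-guarded admissibility** (the monotone-safe instance predicate for v1.3's `adm μ d`): off the Galois locus of `L` every CM
record is admissible (the generator set of r8 only grows — weaker than print), on it `C` must be the reflex side of `Φ`
([Liu21] Def. 4.3 via Shimura §8.3 Prop. 28, which takes the ambient field Galois). [folklore] -/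
def IsReflexOfTypeG (C : LiuCMSide) (Φ : CMType L) : Prop := IsGalois ℚ L → C.IsReflexOfType ι₁ Φ

/-- (J5-corner) for the guarded predicate: at PerL's scope (`L/ℚ` Galois) the guard is discharged and
`isCorner_of_isReflexOfType_liftType` applies. [folklore] -/
theorem isCorner_of_isReflexOfTypeG_liftType [hG : IsGalois ℚ L] (C : LiuCMSide) {K : CMField} (Ψ : CMType K)
    (j : K →+* L) (hP : IsPrimitive (L ≃ₐ[ℚ] L) (pullbackTypeAlg ι₁ Ψ) j.toRatAlgHom)
    (h : C.IsReflexOfTypeG ι₁ (SignRecipe.liftType false K L j ι₁ Ψ)) : C.IsCorner K Ψ (ι₁.comp j) :=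
  isCorner_of_isReflexOfType_liftType C Ψ j hP (h hG)

/-- **`hcorner` AT PerL's SCOPE, in one call**: for `L` a normal closure of the sextic `K` with `[L:ℚ] ∈ {24, 48}` (E's (D1) scope
conjunction), `j : K → L`, any corner type `Ψ`, and a CM record `C` admissible in the Galois-guarded sense for the (J4a) type
`liftType false K L j ι₁ Ψ`: `C.IsCorner K Ψ (ι₁ ∘ j)` — Galois-ness from `CMTypeOps.isGaloisRat_of_isNormalClosure`, primitivity from
binder-2 #85 `isPrimitive_pullbackTypeAlg_of_scope'`. [folklore] -/
theorem isCorner_of_scope {K : CMField} (hN : IsNormalClosure ℚ K L) (hK : Module.finrank ℚ K = 6)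
    (hL : Module.finrank ℚ L = 24 ∨ Module.finrank ℚ L = 48) (j : K →+* L) (Ψ : CMType K) (C : LiuCMSide)
    (h : C.IsReflexOfTypeG ι₁ (SignRecipe.liftType false K L j ι₁ Ψ)) : C.IsCorner K Ψ (ι₁.comp j) := by
  haveI : IsGalois ℚ L := CMTypeOps.isGaloisRat_of_isNormalClosure hN
  exact isCorner_of_isReflexOfTypeG_liftType C Ψ j (SignRecipe.isPrimitive_pullbackTypeAlg_of_scope' hN hK hL j ι₁ Ψ) h

end LiuCMSide

end Model

end HodgeCM

end
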